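/-
Copyright: the b2b-balaban T⁴-continuum CRUX team, row NE7b leaf lineage `t4-ne7b-formalise-leaf-03` (gen 151). Project licence.
-/
import Literature.MathematicalPhysics.QuantumFieldTheory.Balaban1983to89.B6QGQSymbol275Zd
import Summits.QuantumFields.BalabanUV.T4Continuum.Spine.NE7b.OneShotChartBound

/-!
# PARSEVAL'S IDENTITY FOR LATTICE KERNELS AND THE EXACT FIBRE FORMULA OF THE ONE-SHOT CHART:
# `Σ_{x∈ℤ^d} |(2π)^{−d}∫G e^{ip·x}|² = (2π)^{−d}∫|G|²` for EVERY `G` continuous on `[−π,π]^d` (no periodicity), and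
# `Σ′_z (H B)(z)² = (2π)^{−d}∫ (n+1)^d·(Σ_kU_kR_k²∕X²)(p)·|B̂(p)|² dp` — the desk's `S₂∕S²` under the integral, as an IDENTITY
# (row NE7b, node U5c; [folklore] transport to `(ℝ∕ℤ)^d` BY NAME + Mathlib's Parseval `UnitAddTorus.hasSum_sq_mFourierCoeff`)

Cell `pub-balaban`, sub-cell `t4`, spine estimate NE7b (`T4WeightBudget.RelWeightBound`; the cell's OWN estimate — NOT PRINTED in
[Bałaban 1983–89], NOT PROVED).  Crux-route work under `Spine/NE7b/` by leaf-03 (CRUX team (2), FREEZE (0) crux-prover clause), FILING-CLAIM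
C-leaf03-g151-PARSEVAL (journal [NE7bLEAF03-G151-CLAIM-PARSEVAL]).  NOTHING of Bałaban's is asserted; no `T4Continuum/Support` leaf; no
`def`; zero `sorry`.  Used BY NAME: the pv23 transport of `B6QGQSymbol275Zd` §1 (`sect`, `sect_mem_BZ`, `measurable_sect`,
`integral_torus_sect`, `mFourier_sect`), Mathlib's `UnitAddTorus.hasSum_sq_mFourierCoeff`, the OWNER's (42) `OneShotChartBound`
(`HB_chart_eq_latticeKernel`, `continuousOn_rowMult`, `norm_Bhat_sq`, `tsum_row_sq_le`) and (40) `OneShotChartFibreSum` (`sum_normSq_G`,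
`symbR_eq_div`, `Er_pos`).

WHY.  The OWNER's (40)–(42) and the Literature's `B4Eq246SquareSummable` use the BESSEL HALF `Σ_x|K(x)|² ≤ (2π)^{−d}∫|G|²`; that suffices for
upper bounds.  The pricing desk's instrument no. 5 (PRICING-NE7b v120 F713) VALUES the chart constant through the fibre formula
`M^{−d}‖H_M B‖² = (2π)^{−d}∫ (S₂∕S²)|B̂|²` — an IDENTITY, whose supremum over fibres is then the squared operator norm.  This file makes
the identity a theorem, so that «truth 1.326 at d = 4» is a statement about the explicit continuous function
`p ↦ Σ_kU_k(p)R_k(p)² ∕ X(p)²` on the zone (for a calc seat to enclose), not about a bound.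

WHAT IS PROVED ([folklore]):
* §1 **`hasSum_normSq_latticeKernel`** — PARSEVAL: `HasSum (x ↦ ‖latticeKernel G x‖²) ((2π)^{−d}∫_{[−π,π]^d}‖G(p)‖²dp)` for every `G`
  with `p ↦ G(p)` continuous on the zone (the torus function is `G ∘ sect`: bounded, measurable, hence `L²`; its Fourier coefficients
  are `latticeKernel G (−n)` by `mFourier_sect` + `integral_torus_sect`; Parseval on `L²((ℝ∕ℤ)^d)`; reindex by `n ↦ −n`);
  `tsum_normSq_latticeKernel_eq` (the `tsum` form — equality in `B4Eq246SquareSummable.tsum_normSq_latticeKernel_le`).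
* §2 **`tsum_HB_chart_sq_eq`** (each block row of `H B`, `B` supported in `T`: `Σ′_x (HB)(chart n x τ)² = (2π)^{−d}∫‖(G_τ∕symbQGQ)B̂_T‖²`),
  **`tsum_HB_sq_eq_integral`**: `Σ′_z (HB)(z)² = (2π)^{−d}∫ (Σ_τ‖G_τ(p)∕symbQGQ(p)‖²)·FTsq T B p dp`, and the desk's form
  **`tsum_HB_sq_eq_fibreRatio`**: `((n+1)^d)⁻¹ Σ′_z (HB)(z)² = (2π)^{−d}∫ (Σ_kU_k(p)R_k(p)² ∕ X(p)²)·|B̂_T(p)|² dp` (by (40) `sum_normSq_G`,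
  `symbR = X∕E`): the one-shot chart's `η`-norm IS the fibre ratio `S₂∕S²` integrated against `|B̂|²`.

NOT HERE (honest): `sup_p S₂∕S²` as the exact operator norm (needs a concentrating family of `B̂`; the `≤` direction is the owner's (42),
the `≥` direction is not typed); square-summable (non finitely supported) `B` on the identity side; anything of Bałaban's.  BY-NAME EFFECT ON
THE WALL: NONE.  NE7b NOT PRINTED ∕ NOT PROVED; spine PROVED 0∕9; rung (B)+1 on a FINITE torus — NOT infinite volume, NOT the mass gap, NOT
Clay.  HONEST DEPENDENCY: continuum YM on T⁴ ⇐ BetaPertH ∧ nine spine estimates (0∕9 proved); BetaPertH ⇐ (D1) ∧ (D4) ∧ CAP+tail; G-an2-4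
gates asym, D1 and NE2∕3∕4.
-/

set_option autoImplicit false

namespace Summit.QuantumFields.BalabanUV.T4Continuum.NE7b.OneShotChartFibreIdentity

open Finset Complex MeasureTheory Filter Topology Set
open Literature.MathematicalPhysics.QuantumFieldTheory.Balaban1983to89
open B4Strip (ofRealVec Ur Er)
open B4StripSums (G)
open B4ContourShift (BZ latticeKernel fourierBox integrand)
open B4Green244 (phaseC)
open B6QGQLower276 (X chart)
open B5Hk103Minimizer (HB)
open B5Momentum166Zd (FTsq FTsq_nonneg continuous_FTsq isCompact_BZ measurableSet_BZ)
open B6QGQFourier275Zd (symbQGQ symbQGQ_ofReal symbR Rr Xr Xr_ge)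
open B6QGQSymbol275Zd (sect sect_mem_BZ measurable_sect integral_torus_sect mFourier_sect)
open OneShotChartFibreSum (sum_normSq_G symbR_eq_div Er_pos)
open OneShotChartFourier (symbQGQ_ne_zero)
open OneShotChartBound (HB_chart_eq_latticeKernel continuousOn_rowMult norm_Bhat_sq tsum_row_sq_le)
open scoped Real

noncomputable section

variable {d : ℕ}

/-! ## §1. Parseval's identity for lattice kernels -/

/-- **PARSEVAL'S IDENTITY FOR LATTICE KERNELS.**  For a multiplier `G` with `p ↦ G(p)` continuous on `[−π,π]^d`,
`Σ_{x∈ℤ^d} ‖(2π)^{−d}∫_{[−π,π]^d} G(p)e^{ip·x}dp‖² = (2π)^{−d}∫_{[−π,π]^d}‖G(p)‖²dp` as a `HasSum` — the EQUALITY completing the Bessel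
half `B4Eq246SquareSummable.tsum_normSq_latticeKernel_le`.  No periodicity of `G` is needed: the torus function is `G ∘ sect`
(the `(−π,π]^d` section), whose Fourier coefficients are `latticeKernel G (−n)`. [folklore] -/
theorem hasSum_normSq_latticeKernel (Gm : (Fin d → ℂ) → ℂ) (hG : ContinuousOn (fun p : Fin d → ℝ => Gm (ofRealVec p)) (BZ d)) :
    HasSum (fun x : X d => ‖latticeKernel Gm x‖ ^ 2) (((2 * π) ^ d)⁻¹ * ∫ p in BZ d, ‖Gm (ofRealVec p)‖ ^ 2) := by
  -- As in `Mathlib.Analysis.Fourier.AddCircleMulti` and `B6QGQSymbol275Zd`, INSIDE THE PROOF ONLY: the measure on `ℝ∕ℤ` is the Haar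
  -- probability measure (Mathlib's global instance is `ENNReal.ofReal 1 • haarAddCircle`, equal but not definitionally; the transport
  -- lemmas and Parseval are stated for this one); no instance is declared by this file.
  letI : MeasureSpace UnitAddCircle := ⟨AddCircle.haarAddCircle⟩
  haveI : IsProbabilityMeasure (volume : Measure UnitAddCircle) :=
    inferInstanceAs (IsProbabilityMeasure AddCircle.haarAddCircle)
  haveI : IsProbabilityMeasure (volume : Measure (UnitAddTorus (Fin d))) := by rw [volume_pi]; infer_instance
  set h : (Fin d → ℝ) → ℂ := fun q => Gm (ofRealVec q) with hh
  -- the transported function on the torus is bounded and measurable, hence `L²`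
  have hmeas : Measurable fun t : UnitAddTorus (Fin d) => h (sect t) := by
    have h1 : (fun t : UnitAddTorus (Fin d) => h (sect t))
        = (BZ d).restrict h ∘ fun t => (⟨sect t, sect_mem_BZ t⟩ : BZ d) := rfl
    rw [h1]
    exact (continuousOn_iff_continuous_restrict.1 hG).measurable.comp measurable_sect.subtype_mk
  obtain ⟨C, hC⟩ := isCompact_BZ.exists_bound_of_continuousOn hG
  have hLp : MemLp (fun t : UnitAddTorus (Fin d) => h (sect t)) 2 volume :=
    MemLp.of_bound hmeas.aestronglyMeasurable C (Filter.Eventually.of_forall fun t => hC _ (sect_mem_BZ t))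
  -- its Fourier coefficients are the lattice kernel
  have hcoef : ∀ n, UnitAddTorus.mFourierCoeff (fun t : UnitAddTorus (Fin d) => h (sect t)) n = latticeKernel Gm (-n) := by
    intro n
    unfold UnitAddTorus.mFourierCoeff
    have h1 : ∀ t : UnitAddTorus (Fin d), UnitAddTorus.mFourier (-n) t • h (sect t)
        = (fun q => h q * cexp (I * B4ContourShift.phase q (-n))) (sect t) := by
      intro t; rw [mFourier_sect, smul_eq_mul, mul_comm]
    simp_rw [h1]
    rw [integral_torus_sect (d := d) (fun q => h q * cexp (I * B4ContourShift.phase q (-n)))]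
    rfl
  have hcoef' : ∀ n, UnitAddTorus.mFourierCoeff (hLp.toLp _ : UnitAddTorus (Fin d) → ℂ) n = latticeKernel Gm (-n) := fun n => by
    rw [← hcoef n]; exact integral_congr_ae (hLp.coeFn_toLp.mono fun t ht => by simp only [ht])
  have hnorm : ∫ t, ‖(hLp.toLp _ : UnitAddTorus (Fin d) → ℂ) t‖ ^ 2
      = ((2 * π) ^ d)⁻¹ * ∫ p in BZ d, ‖Gm (ofRealVec p)‖ ^ 2 := by
    have h1 : ∫ t, ‖(hLp.toLp _ : UnitAddTorus (Fin d) → ℂ) t‖ ^ 2 = ∫ t : UnitAddTorus (Fin d), ‖h (sect t)‖ ^ 2 :=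
      integral_congr_ae (hLp.coeFn_toLp.mono fun t ht => by simp only [ht])
    rw [h1, integral_torus_sect (fun q => ‖h q‖ ^ 2), smul_eq_mul]
  -- Parseval on `L²((ℝ/ℤ)^d)`, reindexed by `n ↦ −n`
  have hP := UnitAddTorus.hasSum_sq_mFourierCoeff (hLp.toLp _)
  simp_rw [hcoef', hnorm] at hP
  have hP' : HasSum ((fun x : X d => ‖latticeKernel Gm x‖ ^ 2) ∘ (Equiv.neg (X d))) (((2 * π) ^ d)⁻¹ * ∫ p in BZ d, ‖Gm (ofRealVec p)‖ ^ 2) :=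
    hP
  exact (Equiv.hasSum_iff (Equiv.neg (X d))).1 hP'

/-- **Parseval, `tsum` form**: `Σ'_x ‖latticeKernel G x‖² = (2π)^{−d}∫‖G‖²`. [folklore] -/
theorem tsum_normSq_latticeKernel_eq (Gm : (Fin d → ℂ) → ℂ) (hG : ContinuousOn (fun p : Fin d → ℝ => Gm (ofRealVec p)) (BZ d)) :
    ∑' x : X d, ‖latticeKernel Gm x‖ ^ 2 = ((2 * π) ^ d)⁻¹ * ∫ p in BZ d, ‖Gm (ofRealVec p)‖ ^ 2 :=
  (hasSum_normSq_latticeKernel Gm hG).tsum_eq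

/-! ## §2. The exact fibre formula for `‖H B‖²` -/

/-- **Each block row of `H B`, exactly**: for `B` read on the finite window `T`,
`Σ′_x (HB)(chart n x τ)² = (2π)^{−d}∫‖(G_τ∕symbQGQ)(p)·B̂_T(p)‖² dp`. [folklore] -/
theorem tsum_HB_chart_sq_eq (n : ℕ) {a : ℝ} (ha : 0 < a) (T : Finset (X d)) (Bf : X d → ℝ) (τ : Fin d → Fin (n + 1)) :
    ∑' x : X d, HB n a T Bf (chart n x τ) ^ 2 = ((2 * π) ^ d)⁻¹ *
      ∫ p in BZ d, ‖G (n + 1) a 0 τ (ofRealVec p) / symbQGQ (n + 1) a (ofRealVec p)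
        * ∑ y ∈ T, (Bf y : ℂ) * cexp (I * phaseC (ofRealVec p) (-y))‖ ^ 2 := by
  have heq : ∀ x : X d, HB n a T Bf (chart n x τ) ^ 2
      = ‖latticeKernel (fun P => G (n + 1) a 0 τ P / symbQGQ (n + 1) a P
          * ∑ y ∈ T, (Bf y : ℂ) * cexp (I * phaseC P (-y))) x‖ ^ 2 := fun x => by
    rw [← HB_chart_eq_latticeKernel n ha T Bf x τ, Complex.norm_real, Real.norm_eq_abs, sq_abs]
  simp_rw [heq]
  exact tsum_normSq_latticeKernel_eq _ (continuousOn_rowMult n ha τ T Bf)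

/-- **THE EXACT FIBRE FORMULA (multiplier form)**: for `B` read on the finite window `T`,
`Σ′_z (HB)(z)² = (2π)^{−d}∫ (Σ_τ ‖G_τ(p)∕symbQGQ(p)‖²)·|B̂_T(p)|² dp`. [folklore] -/
theorem tsum_HB_sq_eq_integral (n : ℕ) {a : ℝ} (ha : 0 < a) (T : Finset (X d)) (Bf : X d → ℝ) :
    ∑' z : X d, HB n a T Bf z ^ 2 = ((2 * π) ^ d)⁻¹ *
      ∫ p in BZ d, (∑ τ : Fin d → Fin (n + 1), ‖G (n + 1) a 0 τ (ofRealVec p) / symbQGQ (n + 1) a (ofRealVec p)‖ ^ 2)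
        * FTsq T Bf p := by
  -- blocks: `Σ′_z = Σ′_x Σ_τ` over `z = chart n x τ`
  have hS : Summable fun z : X d => HB n a T Bf z ^ 2 := (OneShotChartBound.tsum_HB_sq_le_sharp n ha T Bf).1
  have hblk : ∑' z : X d, HB n a T Bf z ^ 2 = ∑ τ : Fin d → Fin (n + 1), ∑' x : X d, HB n a T Bf (chart n x τ) ^ 2 := by
    rw [← B5Hk103ScalarZd.tsum_blocks n hS]
    have h1 : ∀ x : X d, ∑ q ∈ B6QGQLower276.B n x, HB n a T Bf q ^ 2
        = ∑ τ : Fin d → Fin (n + 1), HB n a T Bf (chart n x τ) ^ 2 := fun x => B6QGQFourier275Zd.sum_B_eq n x _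
    simp_rw [h1]
    exact Summable.tsum_finsetSum fun τ _ => (tsum_row_sq_le n ha T Bf τ).1
  rw [hblk]
  simp_rw [tsum_HB_chart_sq_eq n ha T Bf]
  -- integrability of the row integrands
  have hint : ∀ τ : Fin d → Fin (n + 1), IntegrableOn (fun p : Fin d → ℝ =>
      ‖G (n + 1) a 0 τ (ofRealVec p) / symbQGQ (n + 1) a (ofRealVec p)
        * ∑ y ∈ T, (Bf y : ℂ) * cexp (I * phaseC (ofRealVec p) (-y))‖ ^ 2) (BZ d) := fun τ =>
    ((continuousOn_rowMult n ha τ T Bf).norm.pow 2).integrableOn_compact isCompact_BZ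
  rw [← Finset.mul_sum, ← integral_finsetSum _ fun τ _ => hint τ]
  congr 1
  refine setIntegral_congr_fun measurableSet_BZ fun p _ => ?_
  rw [Finset.sum_mul]
  refine Finset.sum_congr rfl fun τ _ => ?_
  rw [norm_mul, mul_pow, norm_Bhat_sq]

/-- **The fibre multiplier is the desk's `S₂∕S²`**: on the zone,
`Σ_τ ‖G_τ(p)∕symbQGQ(p)‖² = (n+1)^d · (Σ_k U_k(p)R_k(p)²) ∕ X(p)²` (by (40) `sum_normSq_G` and `symbR = X∕E`). [folklore] -/
theorem fibreMultiplier_eq (n : ℕ) {a : ℝ} (ha : 0 < a) (p : Fin d → ℝ) (hp : p ∈ BZ d) :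
    ∑ τ : Fin d → Fin (n + 1), ‖G (n + 1) a 0 τ (ofRealVec p) / symbQGQ (n + 1) a (ofRealVec p)‖ ^ 2
      = ((n : ℝ) + 1) ^ d * (∑ k : Fin d → Fin (n + 1), Ur (n + 1) k p * Rr (n + 1) k p ^ 2) / Xr (n + 1) p ^ 2 := by
  have hE : 0 < Er (n + 1) a 0 p := Er_pos (n + 1) (by omega) ha p hp
  have hX : 0 < Xr (n + 1) p := lt_of_lt_of_le (by positivity) (Xr_ge (n + 1) (by omega) p fun μ => abs_le.mpr ⟨hp.1 μ, hp.2 μ⟩)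
  have hs : symbR (n + 1) a p = Xr (n + 1) p / Er (n + 1) a 0 p := symbR_eq_div (n + 1) a p
  have hs0 : 0 < symbR (n + 1) a p := by rw [hs]; exact div_pos hX hE
  have h1 : ∀ τ : Fin d → Fin (n + 1), ‖G (n + 1) a 0 τ (ofRealVec p) / symbQGQ (n + 1) a (ofRealVec p)‖ ^ 2
      = ‖G (n + 1) a 0 τ (ofRealVec p)‖ ^ 2 / symbR (n + 1) a p ^ 2 := fun τ => by
    rw [norm_div, symbQGQ_ofReal, Complex.norm_real, Real.norm_eq_abs, abs_of_pos hs0, div_pow]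
  simp_rw [h1]
  rw [← Finset.sum_div, sum_normSq_G (n + 1) (by omega) a p hp, hs]
  push_cast
  field_simp

/-- **THE EXACT FIBRE FORMULA OF THE ONE-SHOT CHART (the desk's instrument no. 5 as a theorem)**: for every `n`, `a > 0` and every coarse
field `B` read on a finite window `T`,
`((n+1)^d)⁻¹ · Σ′_z (Σ_{y∈T}B(y)H(z,y))² = (2π)^{−d}∫_{[−π,π]^d} (Σ_kU_k(p)R_k(p)² ∕ X(p)²)·|B̂_T(p)|² dp`
— the `η`-norm of `H B` IS the fibre ratio `S₂∕S²` integrated against `|B̂|²`. [folklore] -/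
theorem tsum_HB_sq_eq_fibreRatio (n : ℕ) {a : ℝ} (ha : 0 < a) (T : Finset (X d)) (Bf : X d → ℝ) :
    (((n : ℝ) + 1) ^ d)⁻¹ * ∑' z : X d, HB n a T Bf z ^ 2 = ((2 * π) ^ d)⁻¹ *
      ∫ p in BZ d, (∑ k : Fin d → Fin (n + 1), Ur (n + 1) k p * Rr (n + 1) k p ^ 2) / Xr (n + 1) p ^ 2 * FTsq T Bf p := by
  have hN : (0 : ℝ) < ((n : ℝ) + 1) ^ d := by positivity
  rw [tsum_HB_sq_eq_integral n ha T Bf]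
  have hcongr : ∫ p in BZ d, (∑ τ : Fin d → Fin (n + 1), ‖G (n + 1) a 0 τ (ofRealVec p) / symbQGQ (n + 1) a (ofRealVec p)‖ ^ 2)
        * FTsq T Bf p
      = ∫ p in BZ d, ((n : ℝ) + 1) ^ d *
          ((∑ k : Fin d → Fin (n + 1), Ur (n + 1) k p * Rr (n + 1) k p ^ 2) / Xr (n + 1) p ^ 2 * FTsq T Bf p) := by
    refine setIntegral_congr_fun measurableSet_BZ fun p hp => ?_
    rw [fibreMultiplier_eq n ha p hp]
    ring
  rw [hcongr, integral_const_mul]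
  field_simp

end

end Summit.QuantumFields.BalabanUV.T4Continuum.NE7b.OneShotChartFibreIdentity
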